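import Literature.NumberTheory.EllipticCurves.TakahashiDegreeFormula
import HarnessLib

/-!
# stub_takahashi — FAMILY-3 (probe the extremes) helper statements, generation 19, ideator k = 3

Companion to `STUB-IDEAS-stub_takahashi-3.md` (crux `DefiniteRTControlPrime`, route `DefiniteXi`).
Everything here is sorry-free and either a `def … : Prop` or a trivial implication; the numerical
certificates quoted in the docstrings are kit jobs `j345502` (2-adic cell census of the consumer)
and `j345510` (refutation of the same-curve-minimality variant).
-/

namespace Summit.ABC.ABC.Cruxes.DefiniteRTControlPrime.StubIdeas3G19

open Literature.NumberTheory.EllipticCurves Literature.NumberTheory.EllipticCurves.ModularForms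
open Literature.NumberTheory.Automorphic

/-- **H19.2 (negative knowledge — do NOT file as a reshape).** The *same-curve-minimality* variant
`W⁻` of Takahashi's Thm. 2.3: the minimality hypothesis on `P` is restricted to parametrization data
of the SAME Weierstrass model `W` (instead of ranging over every `W'` of conductor `M r` with the same
newform, i.e. over the isogeny class).  It is formally STRONGER than the stub (`stub_of_sameCurveMinimal`)
and numerically FALSE: kit job `j345510` tested 175 non-optimal members of the 53 certified `(class, q)`
rows of the g12 census — 78 members in 47 rows admit no `(i, j)`; smallest witness `frey(1,7)`,
`N = 56 = 2³·7`, `(M, r) = (8, 7)`, member at cyclic isogeny distance 4 from the optimal curve with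
`v₇(Δ_min) = 1`, `δ'' = 8`, `ξ = 2`: `i·j = 1 ∧ 8·i = 2·j` is unsolvable (and the one-sided
`δ'' ≤ ξ·c₇'' = 2` consumed by the crux fails too).  So the class-wide `hmin` is load-bearing. -/
def takahashi2001_thm_2_3_sameCurveMinimal : Prop :=
  ∀ (W : WeierstrassCurve ℚ) [W.IsElliptic] (M r : ℕ) [NeZero (M * r)],
    r.Prime → M.Coprime r → W.conductorNorm ℤ = M * r →
    ∀ P : ModularParametrizationData W (M * r),
      (∀ P' : ModularParametrizationData W (M * r),
          P'.f = P.f → P.modularDegree ≤ P'.modularDegree) →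
      ∀ S : Brandt.XiSetup M r,
        ∃ i j : ℕ, 0 < i ∧ i * j = (W.minimalDiscriminantNorm ℤ).factorization r ∧
          i ∣ S.xi (fun n => W.LFunction n) ∧
          P.modularDegree * i = S.xi (fun n => W.LFunction n) * j

/-- The variant `W⁻` implies the stub's fact (it only weakens the minimality hypothesis it grants
itself).  Recorded to make the direction of strength explicit; the converse is what fails. -/
theorem stub_of_sameCurveMinimal (h : takahashi2001_thm_2_3_sameCurveMinimal) :
    takahashi2001_thm_2_3_of_coprime := by
  intro W _ M r _ hr hcop hN P hmin S
  exact h W M r hr hcop hN P (fun P' hP' => hmin W hN P' hP') S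

/-- **H19.3 (the R-cell of the consumer).** The only instances of the fact the crux
`DefiniteRTControlPrime` ever instantiates (via `deg_le_of_optimalIsogenyAt`): `r` an ODD prime and
`M` of the shape forced on a Frey conductor by `(freyCurve a b).conductorNorm ℤ ∣ 2^8 · rad(abc)`
(`Szpiro.lean`), i.e. `v₂(M) ≤ 8` and the odd part of `M` square-free.  Kit job `j345502` (stage A,
109 589 coprime pairs `|a| ≤ 300`) measured the finer truth `v₂(N_Frey) ∈ {0,1,3,4,5}` (never 2, 6, 7, 8),
a function of `(v₂ a, v₂ b, v₂ c, odd parts mod 8)` with 0 inconsistencies over 328 residue patterns. -/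
def takahashi2001_thm_2_3_atFreyLevels : Prop :=
  ∀ (W : WeierstrassCurve ℚ) [W.IsElliptic] (M r : ℕ) [NeZero (M * r)],
    r.Prime → r ≠ 2 → M.Coprime r → M.factorization 2 ≤ 8 →
    Squarefree (M / 2 ^ M.factorization 2) → W.conductorNorm ℤ = M * r →
    ∀ P : ModularParametrizationData W (M * r),
      (∀ (W' : WeierstrassCurve ℚ) [W'.IsElliptic], W'.conductorNorm ℤ = M * r →
          ∀ P' : ModularParametrizationData W' (M * r),
          P'.f = P.f → P.modularDegree ≤ P'.modularDegree) →
      ∀ S : Brandt.XiSetup M r,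
        ∃ i j : ℕ, 0 < i ∧ i * j = (W.minimalDiscriminantNorm ℤ).factorization r ∧
          i ∣ S.xi (fun n => W.LFunction n) ∧
          P.modularDegree * i = S.xi (fun n => W.LFunction n) * j

/-- The stub's fact restricts to the Frey cell (trivial direction).  The content-bearing converse for
the ROUTE — `takahashi2001_thm_2_3_atFreyLevels → DefiniteRTControlPrime`, re-threading
`definiteRTControlPrime_of_takahashi` with the two extra hypotheses discharged from `Szpiro.lean`'s
`conductorNorm ∣ 2^8 · radical` — is an M-sized prover target named in the sheet, not stated here. -/
theorem atFreyLevels_of_stub (h : takahashi2001_thm_2_3_of_coprime) :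
    takahashi2001_thm_2_3_atFreyLevels := by
  intro W _ M r _ hr _ hcop _ _ hN P hmin S
  exact h W M r hr hcop hN P hmin S

/-- **H19.5 (tightness of the consumed inequality, bookkeeping).** Takahashi's `(i, j)` with
`i * j = c_r` and `δ * i = ξ * j` give the exact relation `δ · i² = ξ · c_r`; in particular the
one-sided inequality `δ ≤ ξ · c_r` that the crux consumes is an EQUALITY whenever `i = 1` — which is
the case in 49 of the 57 certified Frey rows (53 rows of the g12 census `j345095` + 4 rows of `j345502`
stage B2); the remaining 8 rows have `i = 2`, `δ = ξ · c_r / 4`.  Pure arithmetic over `ℕ`. -/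
theorem deg_mul_sq_eq (δ ξ c i j : ℕ) (hij : i * j = c) (hdeg : δ * i = ξ * j) :
    δ * i * i = ξ * c := by
  subst hij
  calc δ * i * i = ξ * j * i := by rw [hdeg]
    _ = ξ * (i * j) := by ring

end Summit.ABC.ABC.Cruxes.DefiniteRTControlPrime.StubIdeas3G19
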